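import Summits.QuantumFields.YangMills.Theorems.IR.LargeFieldRarityOddTori
import Summits.QuantumFields.YangMills.Theorems.IR.PressureMonotoneTMEquipartition
import Summits.QuantumFields.YangMills.Theorems.LangevinControlUVFemtoCurvatureTwoPointCUniformDoublingAll
import HarnessLib

/-!
# Crux `IR` (stmt-QuantumFields-19354) ∕ crux `NT` (stmt-QuantumFields-19353): the free-energy increment on ALL tori —
# the typed residual (FE<) `FreeEnergyIncrementBelow` HOLDS, hence LINE 3's large-field rarity (R)/(R<) on ALL odd tori
# and the floor-free uniform equipartition, BY NAME — hypothesis-free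

Fleet lead prover of crux `NT` (unit `ym-spine-19353-p1`, g28), `--supports` helper.  A junction of two routes that had
not been drawn.  The IR line 4 package `Theorems/IR/LargeFieldRarityDefs` (ideator ym-ir-idea-4, lead ab-p1) proves the
free-energy increment (FE) `log Z_L(β') − log Z_L(β) ≤ ν₀ L⁴ log(β/β') + C L⁴` ABOVE the explicit volume floor
`L ≥ volFloor β = (⌈β⌉₊+2)²` (Chatterjee's thermodynamic-limit asymptotics + finite-size bounds) and records the same bound
BELOW the floor as the typed residual (FE<) `FreeEnergyIncrementBelow` — «OPEN, research M; finite-torus Laplace asymptotics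
with an `O(L⁴)`-sharp mode count; torons» — to which LINE 3's (R) on ALL odd tori (`LargeFieldRarityAllOddTori`) and its
small-torus part (R<) (`LargeFieldRaritySmallTori`) are reduced BY NAME (`largeFieldRarityAllOddTori_of_below`,
`largeFieldRaritySmallTori_of_below`), and which `Theorems/IR/PressureMonotoneTMEquipartition` (§8–§9) identifies with the
floor-free uniform equipartition `UniformEquipartitionFrom (fun _ => 2)` («OPEN (torons)»).

The other route has it.  Crux `FemtoCurvatureTwoPointC` of route `LangevinControlUV` landed (2026-08-17) the volume-UNIFORM
doubling of the torus partition function on ALL tori, for every compact second-countable `G` and every lattice representation: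
`Summit.QuantumFields.YangMills.Theorems.FemtoCurvatureTwoPointC.TorusGauge.uniformDoubling_all` — ONE `A = A(r)` with `Z_L(b/2) ≤ e^{A L⁴} Z_L(b)` for every `L ≥ 2`, `b ≥ 4` (holonomy-conditioned
torus free-energy sandwich: comb gauge + lattice Stokes + the iterated one-site doubling across the temperature mismatch; the four
wrap links = the toron sector are exactly what the axis-holonomy conditioning pays for), and `Summit.QuantumFields.YangMills.Theorems.FemtoCurvatureTwoPointC.oneSite_partitionFunction_doubling`
(`Z₁(b/4) ≤ K Z₁(b)`, all `b > 0`) for the one-site torus.  Iterating the halving `⌈log₂(β/β')⌉` times gives (FE) with NO volume floor: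

* §1 `torusLogPartition_sub_le_of_halving` (iterated halving, `n` steps), `exists_halving_all_tori` (ONE halving constant for ALL
  `L ≥ 1`, `b ≥ 4`), **`exists_torusLogPartition_sub_le_all_tori`** — for every compact second-countable `G` and lattice
  representation `r` there is `A ≥ 0` with `log Z_L(β') − log Z_L(β) ≤ (A/log 2)·L⁴·log(β/β') + A·L⁴` for ALL tori `L ≥ 1` and
  all `4 ≤ β' ≤ β`.
* §2 **`freeEnergyIncrementBelow_holds : FreeEnergyIncrementBelow`** (the typed residual (FE<), with `β₃ = 4`; the hypothesis
  `L < volFloor β` is not used), `freeEnergyIncrementFrom_holds : ∀ fl, FreeEnergyIncrementFrom fl` (in particular floor `0`).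
* §3 BY NAME: **`largeFieldRarityAllOddTori_holds : LargeFieldRarityAllOddTori`** (LINE 3's re-typed (R): β-uniform FIXED-threshold
  large-field rarity `μ_{L,β}{∀ p ∈ Q, s_p > A/(2β)} ≤ e^{−c A #Q}` on ALL odd tori `2S+1 ≥ 3`, one rate `c` for `A ≥ A₀`, no volume
  floor), `largeFieldRaritySmallTori_holds : LargeFieldRaritySmallTori` ((R<)), and
  **`uniformEquipartitionFrom_holds : ∀ fl, UniformEquipartitionFrom fl`** — floor-free uniform equipartition `β·⟨S⟩_{Λ_L,β} ≤ c·L⁴`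
  on ALL tori `L ≥ 1`, `β ≥ β₃`, for every compact simple `G` (idea-4's residual R<).

HONEST FRAMING.  Bookkeeping: the mathematics is the landed torus sandwich of `FemtoCurvatureTwoPointC` (seats of route
`LangevinControlUV`) and the landed chessboard engine of IR line 4; this file only joins them.  Kinematic, weak-coupling, holds for
every compact gauge group; it is the supplier (R) of LINE 3 ∕ NT's rows (R)/(B4), NOT the IR-hard core (T)/(M-b), not a lattice
gap, not `BalabanLadder.IR`, not `BalabanLadder.NT`; the Yang–Mills mass gap is NOT proved; not Clay.
Refs: S. Chatterjee, JFA 271 (2016) Thm. 2.1 [arXiv160201222]; Fröhlich–Israel–Lieb–Simon, CMP 62 (1978) §4 (chessboard).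
-/

set_option autoImplicit false

noncomputable section

open MeasureTheory Filter
open Literature.MathematicalPhysics.QuantumFieldTheory Literature.MathematicalPhysics.QuantumLattice
open Summit.QuantumFields.YangMills.Theorems.FemtoCurvatureTwoPoint.PlaquetteVariance (partitionFunction_toReal_pos)
open Summit.QuantumFields.YangMills.Cruxes.IR.PressureMonotoneTM (UniformEquipartitionFrom
  uniformEquipartitionFrom_of_freeEnergyIncrementFrom)

namespace Summit.QuantumFields.YangMills.Cruxes.IR.LargeFieldRarityChessboard

/-! ## §1 Iterated halving of the torus partition function on ALL tori -/

section Halving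

variable {G : Type} [Group G] [TopologicalSpace G] [IsTopologicalGroup G] [CompactSpace G]
  [MeasurableSpace G] [BorelSpace G]

/-- **Iterated halving.**  If `Z_L(b/2) ≤ e^{E} Z_L(b)` for all `b ≥ b₀` (`E ≥ 0`), then for `b₀ ≤ β' ≤ β ≤ 2ⁿ β'`:
`log Z_L(β') − log Z_L(β) ≤ n·E` (induction on `n`; the partition function is antitone in the coupling). [folklore] -/
theorem torusLogPartition_sub_le_of_halving (r : LatticeRep G) {L : ℕ} [NeZero L] {E b₀ : ℝ} (hE : 0 ≤ E)
    (hdbl : ∀ b : ℝ, b₀ ≤ b → (partitionFunction (d := 4) (L := L) r.ρ (b / 2)).toReal ≤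
      Real.exp E * (partitionFunction (d := 4) (L := L) r.ρ b).toReal) :
    ∀ (n : ℕ) (β' β : ℝ), b₀ ≤ β' → β' ≤ β → β ≤ 2 ^ n * β' →
      torusLogPartition 4 r.ρ β' L - torusLogPartition 4 r.ρ β L ≤ n * E := by
  have hZpos : ∀ b : ℝ, 0 < (partitionFunction (d := 4) (L := L) r.ρ b).toReal :=
    fun b => partitionFunction_toReal_pos (d := 4) (L := L) r.ρ r.continuous b
  -- one halving step in logarithms
  have hstep : ∀ b : ℝ, b₀ ≤ b →
      torusLogPartition 4 r.ρ (b / 2) L - torusLogPartition 4 r.ρ b L ≤ E := by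
    intro b hb
    have h := hdbl b hb
    have h1 : Real.log (partitionFunction (d := 4) (L := L) r.ρ (b / 2)).toReal ≤
        E + Real.log (partitionFunction (d := 4) (L := L) r.ρ b).toReal := by
      have := Real.log_le_log (hZpos _) h
      rwa [Real.log_mul (Real.exp_pos _).ne' (hZpos _).ne', Real.log_exp] at this
    unfold torusLogPartition
    linarith
  -- antitonicity in logarithms
  have hanti : ∀ b b' : ℝ, b ≤ b' →
      torusLogPartition 4 r.ρ b' L ≤ torusLogPartition 4 r.ρ b L := by
    intro b b' hbb'
    unfold torusLogPartition
    exact Real.log_le_log (hZpos _) (Summit.QuantumFields.YangMills.Theorems.FemtoCurvatureTwoPointC.TorusGauge.partitionFunction_antitone r hbb')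
  intro n
  induction n with
  | zero =>
    intro β' β _ hle hpow
    have hββ' : β = β' := le_antisymm (by simpa using hpow) hle
    subst hββ'
    simp
  | succ n ih =>
    intro β' β hb' hle hpow
    by_cases h2 : β ≤ 2 * β'
    · -- one step suffices: `Z(β') ≤ Z(β/2)` (antitone, `β/2 ≤ β'`) and the halving at `b = β`
      have hβb₀ : b₀ ≤ β := le_trans hb' hle
      have ha : torusLogPartition 4 r.ρ β' L ≤ torusLogPartition 4 r.ρ (β / 2) L :=
        hanti (β / 2) β' (by linarith)
      have hs := hstep β hβb₀
      have hn : (0 : ℝ) ≤ n * E := mul_nonneg (Nat.cast_nonneg _) hE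
      push_cast
      linarith
    · -- `β > 2β'`: induction hypothesis on `[β', β/2]`, then one halving at `b = β`
      push Not at h2
      have hle' : β' ≤ β / 2 := by linarith
      have hpow' : β / 2 ≤ 2 ^ n * β' := by
        rw [pow_succ] at hpow
        have : β ≤ 2 * (2 ^ n * β') := by linarith [hpow]
        linarith
      have hih := ih β' (β / 2) hb' hle' hpow'
      have hβb₀ : b₀ ≤ β := le_trans hb' hle
      have hs := hstep β hβb₀
      push_cast
      linarith

/-- **ONE halving constant for ALL tori** (`L ≥ 1`, `b ≥ 4`): for a compact second-countable `G` and a lattice representation `r`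
there is `A ≥ 0` with `Z_L(b/2) ≤ e^{A L⁴} Z_L(b)` for every torus `(ℤ/L)⁴`, `L ≥ 1`, and every `b ≥ 4` — the landed
`Summit.QuantumFields.YangMills.Theorems.FemtoCurvatureTwoPointC.TorusGauge.uniformDoubling_all` (`L ≥ 2`) and `Summit.QuantumFields.YangMills.Theorems.FemtoCurvatureTwoPointC.oneSite_partitionFunction_doubling` (`L = 1`: `Z₁(b/2) ≤ Z₁(b/4) ≤ K Z₁(b)`).
[folklore] -/
theorem exists_halving_all_tori [SecondCountableTopology G] (r : LatticeRep G) :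
    ∃ A : ℝ, 0 ≤ A ∧ ∀ (L : ℕ) [NeZero L] (b : ℝ), 4 ≤ b →
      (partitionFunction (d := 4) (L := L) r.ρ (b / 2)).toReal ≤
        Real.exp (A * (L : ℝ) ^ 4) * (partitionFunction (d := 4) (L := L) r.ρ b).toReal := by
  obtain ⟨A₂, hA₂⟩ := Summit.QuantumFields.YangMills.Theorems.FemtoCurvatureTwoPointC.TorusGauge.uniformDoubling_all r
  obtain ⟨K, hK⟩ := Summit.QuantumFields.YangMills.Theorems.FemtoCurvatureTwoPointC.oneSite_partitionFunction_doubling G r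
  set K' : ℝ := max K 1 with hK'
  have hK'1 : 1 ≤ K' := le_max_right _ _
  have hK'pos : 0 < K' := lt_of_lt_of_le one_pos hK'1
  set A : ℝ := max (max A₂ (Real.log K')) 0 with hA
  refine ⟨A, le_max_right _ _, ?_⟩
  intro L _ b hb
  have hL1 : 1 ≤ L := Nat.one_le_iff_ne_zero.2 (NeZero.ne L)
  have hZpos : ∀ b : ℝ, 0 < (partitionFunction (d := 4) (L := L) r.ρ b).toReal :=
    fun b => partitionFunction_toReal_pos (d := 4) (L := L) r.ρ r.continuous b
  rcases Nat.eq_or_lt_of_le hL1 with hL | hL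
  · -- `L = 1`
    subst hL
    have hb0 : 0 < b := by linarith
    have h1 : (partitionFunction (d := 4) (L := 1) r.ρ (b / 2)).toReal ≤
        (partitionFunction (d := 4) (L := 1) r.ρ (b / 4)).toReal :=
      Summit.QuantumFields.YangMills.Theorems.FemtoCurvatureTwoPointC.TorusGauge.partitionFunction_antitone r (by linarith)
    have h2 := hK b hb0
    have h3 : K * (partitionFunction (d := 4) (L := 1) r.ρ b).toReal ≤
        K' * (partitionFunction (d := 4) (L := 1) r.ρ b).toReal :=
      mul_le_mul_of_nonneg_right (le_max_left _ _) (hZpos b).le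
    have h4 : K' ≤ Real.exp (A * ((1 : ℕ) : ℝ) ^ 4) := by
      rw [Nat.cast_one, one_pow, mul_one]
      calc K' = Real.exp (Real.log K') := (Real.exp_log hK'pos).symm
        _ ≤ Real.exp A := Real.exp_le_exp.2 ((le_max_right _ _).trans (le_max_left _ _))
    calc (partitionFunction (d := 4) (L := 1) r.ρ (b / 2)).toReal
        ≤ K' * (partitionFunction (d := 4) (L := 1) r.ρ b).toReal := h1.trans (h2.trans h3)
      _ ≤ Real.exp (A * ((1 : ℕ) : ℝ) ^ 4) * (partitionFunction (d := 4) (L := 1) r.ρ b).toReal :=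
          mul_le_mul_of_nonneg_right h4 (hZpos b).le
  · -- `L ≥ 2`
    have hL2 : 2 ≤ L := hL
    have h := hA₂ L b hL2 hb
    have hmono : Real.exp (A₂ * (L : ℝ) ^ 4) ≤ Real.exp (A * (L : ℝ) ^ 4) :=
      Real.exp_le_exp.2 (mul_le_mul_of_nonneg_right ((le_max_left _ _).trans (le_max_left _ _)) (by positivity))
    exact h.trans (mul_le_mul_of_nonneg_right hmono (hZpos b).le)

/-- **The free-energy increment on ALL tori.**  For a compact second-countable `G` and a lattice representation `r` there is
`A ≥ 0` such that for EVERY torus `(ℤ/L)⁴`, `L ≥ 1`, and all `4 ≤ β' ≤ β`: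
`log Z_L(β') − log Z_L(β) ≤ (A / log 2) · L⁴ · log(β/β') + A · L⁴` (halve `⌈log₂(β/β')⌉ ≤ log₂(β/β') + 1` times). [folklore] -/
theorem exists_torusLogPartition_sub_le_all_tori [SecondCountableTopology G] (r : LatticeRep G) :
    ∃ A : ℝ, 0 ≤ A ∧ ∀ (L : ℕ) [NeZero L] (β' β : ℝ), 4 ≤ β' → β' ≤ β →
      torusLogPartition 4 r.ρ β' L - torusLogPartition 4 r.ρ β L ≤
        A / Real.log 2 * (L : ℝ) ^ 4 * Real.log (β / β') + A * (L : ℝ) ^ 4 := by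
  obtain ⟨A, hA0, hA⟩ := exists_halving_all_tori r
  refine ⟨A, hA0, ?_⟩
  intro L _ β' β hβ' hle
  have hβ'0 : 0 < β' := by linarith
  have hq1 : 1 ≤ β / β' := (one_le_div hβ'0).2 hle
  have hlog2 : 0 < Real.log 2 := Real.log_pos one_lt_two
  -- number of halvings
  set x : ℝ := Real.logb 2 (β / β') with hx
  have hx0 : 0 ≤ x := Real.logb_nonneg one_lt_two hq1
  set n : ℕ := ⌈x⌉₊ with hn
  have hnx : x ≤ n := Nat.le_ceil x
  have hn1 : (n : ℝ) < x + 1 := Nat.ceil_lt_add_one hx0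
  have hpow : β ≤ 2 ^ n * β' := by
    have h1 : β / β' ≤ (2 : ℝ) ^ (n : ℝ) := by
      calc β / β' = (2 : ℝ) ^ x := (Real.rpow_logb two_pos (by norm_num) (lt_of_lt_of_le one_pos hq1)).symm
        _ ≤ (2 : ℝ) ^ (n : ℝ) := Real.rpow_le_rpow_of_exponent_le one_le_two hnx
    rw [Real.rpow_natCast] at h1
    rwa [div_le_iff₀ hβ'0] at h1
  have hE : 0 ≤ A * (L : ℝ) ^ 4 := by positivity
  have hmain := torusLogPartition_sub_le_of_halving r (L := L) hE (fun b hb => hA L b hb) n β' β hβ' hle hpow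
  -- `n ≤ log(β/β')/log 2 + 1`
  have hxlog : x = Real.log (β / β') / Real.log 2 := by rw [hx, Real.logb]
  have hnle : (n : ℝ) ≤ Real.log (β / β') / Real.log 2 + 1 := by rw [← hxlog]; exact hn1.le
  calc torusLogPartition 4 r.ρ β' L - torusLogPartition 4 r.ρ β L ≤ n * (A * (L : ℝ) ^ 4) := hmain
    _ ≤ (Real.log (β / β') / Real.log 2 + 1) * (A * (L : ℝ) ^ 4) := mul_le_mul_of_nonneg_right hnle hE
    _ = A / Real.log 2 * (L : ℝ) ^ 4 * Real.log (β / β') + A * (L : ℝ) ^ 4 := by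
        field_simp

end Halving

/-! ## §2 The typed residual (FE<) and the increment at every floor -/

/-- **(FE<) HOLDS**: the free-energy increment below the volume floor — in fact on every torus `L ≥ 1` and for all
`4 ≤ β' ≤ β`, with `ν₀ = A/log 2`, `C = A`, `β₃ = 4` (the hypothesis `L < volFloor β` is not used).  This is the typed residual of
`Theorems/IR/LargeFieldRarityDefs` («OPEN, research M; torons»), discharged by the landed torus doubling of crux
`FemtoCurvatureTwoPointC` (`Summit.QuantumFields.YangMills.Theorems.FemtoCurvatureTwoPointC.TorusGauge.uniformDoubling_all`). [folklore] -/
theorem freeEnergyIncrementBelow_holds : FreeEnergyIncrementBelow := by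
  intro G _ _ _ _ _hG
  letI : MeasurableSpace G := borel G
  haveI : BorelSpace G := ⟨rfl⟩
  intro r
  haveI := r.secondCountableTopology
  obtain ⟨A, hA0, hA⟩ := exists_torusLogPartition_sub_le_all_tori r
  refine ⟨A / Real.log 2, A, 4, by norm_num, ?_⟩
  intro L _ β' β hβ' hle _
  exact hA L β' β hβ' hle

/-- **(FE) at EVERY volume floor** (in particular floor `0`: ALL tori), unconditionally. [folklore] -/
theorem freeEnergyIncrementFrom_holds (fl : ℝ → ℕ) : FreeEnergyIncrementFrom fl := by
  intro G _ _ _ _ _hG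
  letI : MeasurableSpace G := borel G
  haveI : BorelSpace G := ⟨rfl⟩
  intro r
  haveI := r.secondCountableTopology
  obtain ⟨A, hA0, hA⟩ := exists_torusLogPartition_sub_le_all_tori r
  refine ⟨A / Real.log 2, A, 4, by norm_num, ?_⟩
  intro L _ β' β hβ' hle _
  exact hA L β' β hβ' hle

/-- (FE) on ALL tori (floor `0`), the form consumed by the line-4 engine `largeFieldRarityOn_of_ZRatio`. [folklore] -/
theorem freeEnergyIncrementFrom_zero_holds : FreeEnergyIncrementFrom (fun _ => 0) :=
  freeEnergyIncrementFrom_holds _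

/-! ## §3 Consequences BY NAME: LINE 3's (R)/(R<) on all odd tori, floor-free uniform equipartition -/

/-- **LINE 3's (R) on ALL odd tori `≥ 3` — β-uniform fixed-threshold large-field rarity, no volume floor** (the typed
`LargeFieldRarityAllOddTori` of `Theorems/IR/LargeFieldRarityDefs`): for every compact simple `G` and lattice representation `r`
there are `c > 0`, `A₀`, `β₃` with `μ_{2S+1,β}{U | ∀ p ∈ Q, A/(2β) < s_p(U)} ≤ e^{−c·A·#Q}` for all `A ≥ A₀`, `β ≥ β₃`, `S ≥ 1` and
every plaquette family `Q` — `largeFieldRarityAllOddTori_of_below` fed with (FE<). [folklore] -/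
theorem largeFieldRarityAllOddTori_holds : LargeFieldRarityAllOddTori :=
  largeFieldRarityAllOddTori_of_below freeEnergyIncrementBelow_holds

/-- **LINE 3's (R<)** (`LargeFieldRaritySmallTori`: the small odd tori `2S+1 < volFloor β`), unconditionally. [folklore] -/
theorem largeFieldRaritySmallTori_holds : LargeFieldRaritySmallTori :=
  largeFieldRaritySmallTori_of_below freeEnergyIncrementBelow_holds

/-- **Floor-free uniform equipartition** (`PressureMonotoneTM.UniformEquipartitionFrom fl` for EVERY floor `fl`, in particular
`fun _ => 2` and `fun _ => 0`): for every compact simple `G` and lattice representation `r` there are `c, β₃ > 0` with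
`β·⟨S⟩_{Λ_L,β} ≤ c·L⁴` for all `β ≥ β₃` and ALL tori `L ≥ fl β` — idea-4's floor-free residual R< of
`Theorems/IR/PressureMonotoneTMEquipartition` §8, by `uniformEquipartitionFrom_of_freeEnergyIncrementFrom`. [folklore] -/
theorem uniformEquipartitionFrom_holds (fl : ℝ → ℕ) : UniformEquipartitionFrom fl :=
  uniformEquipartitionFrom_of_freeEnergyIncrementFrom (freeEnergyIncrementFrom_holds fl)

/-- Floor-free uniform equipartition on ALL tori `L ≥ 2` (the residual `UniformEquipartitionFrom (fun _ => 2)` of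
`PressureMonotoneTM.freeEnergyIncrementFrom_two_iff`), unconditionally. [folklore] -/
theorem uniformEquipartitionFrom_two_holds : UniformEquipartitionFrom (fun _ => 2) :=
  uniformEquipartitionFrom_holds _

end Summit.QuantumFields.YangMills.Cruxes.IR.LargeFieldRarityChessboard

end
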